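import Mathlib
import HarnessLib
import Summits.Ventures.LatticeQCDFlow.Exactness.SpectralKernelJacobianWeylShapeSU
import Summits.Ventures.LatticeQCDFlow.Exactness.SpectralKernelJacobianWeylShape

/-!
# Boyda's Jacobian identity needs checking only at regular spectra: at a degenerate torus point both sides vanish

HONEST FRAMING: exact (Metropolis-corrected) sampling algorithms for lattice gauge theory;
figures of merit are autocorrelation/cost numbers at stated couplings and volumes; no
continuum-physics claim.

Venture `LatticeQCDFlow` (cell pub-lqcd), topic `Exactness`; FANOUT row 10 (`eng-equiv`, engine
`latflow.equiv`, `spectral.py`: the Haar/Vandermonde factor `log |Δ(f λ)|² − log |Δ(λ)|²` is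
singular exactly on the cell walls, where the engine's canonicalisation ties the images of tied
eigenvalues).  NEW WORK of the cell over `SpectralKernelJacobianWeylShape[SU].lean` (the identity
`J(g t g⁻¹)·D t = J_f t·D(f_T t)` with `D = |Δ|²/n!` as a hypothesis for ALL `t`) and
`SpectralKernelConjugation.apply_eq_apply_of_perm_equivariant` (tied eigenvalues have tied images);
nothing is cited as a fact; no number; no definition is introduced.  Printed counterpart, NAMED
ONLY: Boyda et al., PRD 103 (2021) 074504, eq. (19) and §III.D (cells and their walls).

## What is typed

* `vandermondeWeight_eq_zero_of_tie` — if two diagonal entries of `t` coincide, the Vandermonde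
  weight `(∏_i ∏_{k≠i} ‖t_ii − t_kk‖)/n!` vanishes;
* `torusMap_tie` — a torus map `f_T(diag d) = diag(f d)` of a permutation-equivariant `f` maps
  tied entries to tied entries;
* **`vandermondeIdentity_of_regular_specialUnitary`** / **`…_unitary`** — THE REDUCTION: if
  Boyda's identity `J(g t g⁻¹)·D t = J_f t·D(f_T t)` holds at every REGULAR `t` (pairwise distinct
  diagonal entries), it holds at every `t` — at a degenerate `t` both sides are `0`.  So the
  hypothesis `hJ` of `hasJacobian_spectralKernel_{specialUnitaryGroup,unitaryGroup}_of_weyl` and of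
  `SpectralCouplingLayerExactness.lean` is a condition on the open cells only, where the engine's
  log-det is smooth.

NOT here: that the walls are Haar-null; any number.
-/

noncomputable section

namespace Summit.Ventures.LatticeQCDFlow.Exactness

open MeasureTheory Matrix Topology
open Literature.LinearAlgebra.Matrix
open scoped ENNReal

variable {n : Type*} [Fintype n] [DecidableEq n]

/-- **A tie kills the Vandermonde weight**: if `d i = d j` for some `i ≠ j` then
`(∏_a ∏_{b ≠ a} ‖d a − d b‖) / n! = 0`. -/
theorem vandermondeWeight_eq_zero_of_tie {d : n → ℂ} {i j : n} (hij : i ≠ j) (hd : d i = d j) :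
    (∏ a, ∏ b ∈ Finset.univ.erase a, ‖d a - d b‖) / ((Fintype.card n).factorial : ℝ) = 0 := by
  have hinner : ∏ b ∈ Finset.univ.erase i, ‖d i - d b‖ = 0 :=
    Finset.prod_eq_zero (Finset.mem_erase.mpr ⟨hij.symm, Finset.mem_univ j⟩) (by rw [hd, sub_self, norm_zero])
  rw [Finset.prod_eq_zero (Finset.mem_univ i) hinner, zero_div]

omit [Fintype n] in
/-- **A torus map of a permutation-equivariant eigenvalue map preserves ties**: if
`f_T(diag d) = diag(f d)` entrywise and `d i = d j`, then `(f_T t)_ii = (f_T t)_jj`. -/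
theorem torusMap_tie {f : (n → ℂ) → (n → ℂ)}
    (hf : ∀ (σ : Equiv.Perm n) (d : n → ℂ), f (fun k => d (σ k)) = fun k => f d (σ k))
    {d e : n → ℂ} (he : ∀ k, e k = f d k) {i j : n} (hd : d i = d j) : e i = e j := by
  rw [he, he]
  exact apply_eq_apply_of_perm_equivariant hf hd

/-- **Boyda's identity needs checking only at regular spectra (`SU(n)`).**  For a
permutation-equivariant `f` with torus map `f_T` (`f_T(diag d) = diag(f d)`): if
`J(g t g⁻¹) · D t = J_f t · D (f_T t)` with `D = |Δ|²/n!` holds whenever the diagonal entries of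
`t` are pairwise distinct, it holds for all `g`, `t` — at a tie both `D t` and `D (f_T t)`
vanish. -/
theorem vandermondeIdentity_of_regular_specialUnitary {f : (n → ℂ) → (n → ℂ)}
    (hf : ∀ (σ : Equiv.Perm n) (d : n → ℂ), f (fun k => d (σ k)) = fun k => f d (σ k))
    {fT : specialDiagonalTorus n → specialDiagonalTorus n}
    (hfT : ∀ t : specialDiagonalTorus n, ((fT t : Matrix.specialUnitaryGroup n ℂ) : Matrix n n ℂ) =
      diagonal (f fun i => ((t : Matrix.specialUnitaryGroup n ℂ) : Matrix n n ℂ) i i))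
    {J : Matrix.specialUnitaryGroup n ℂ → ℝ≥0∞} {Jf : specialDiagonalTorus n → ℝ≥0∞}
    (hreg : ∀ (g : Matrix.specialUnitaryGroup n ℂ) (t : specialDiagonalTorus n),
      (∀ i j, i ≠ j → ((t : Matrix.specialUnitaryGroup n ℂ) : Matrix n n ℂ) i i ≠
        ((t : Matrix.specialUnitaryGroup n ℂ) : Matrix n n ℂ) j j) →
      J (g * (t : Matrix.specialUnitaryGroup n ℂ) * g⁻¹) * ENNReal.ofReal
          ((∏ i, ∏ k ∈ Finset.univ.erase i,
            ‖((t : Matrix.specialUnitaryGroup n ℂ) : Matrix n n ℂ) i i -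
              ((t : Matrix.specialUnitaryGroup n ℂ) : Matrix n n ℂ) k k‖) / (Fintype.card n).factorial) =
        Jf t * ENNReal.ofReal
          ((∏ i, ∏ k ∈ Finset.univ.erase i,
            ‖((fT t : Matrix.specialUnitaryGroup n ℂ) : Matrix n n ℂ) i i -
              ((fT t : Matrix.specialUnitaryGroup n ℂ) : Matrix n n ℂ) k k‖) / (Fintype.card n).factorial))
    (g : Matrix.specialUnitaryGroup n ℂ) (t : specialDiagonalTorus n) :
    J (g * (t : Matrix.specialUnitaryGroup n ℂ) * g⁻¹) * ENNReal.ofReal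
        ((∏ i, ∏ k ∈ Finset.univ.erase i,
          ‖((t : Matrix.specialUnitaryGroup n ℂ) : Matrix n n ℂ) i i -
            ((t : Matrix.specialUnitaryGroup n ℂ) : Matrix n n ℂ) k k‖) / (Fintype.card n).factorial) =
      Jf t * ENNReal.ofReal
        ((∏ i, ∏ k ∈ Finset.univ.erase i,
          ‖((fT t : Matrix.specialUnitaryGroup n ℂ) : Matrix n n ℂ) i i -
            ((fT t : Matrix.specialUnitaryGroup n ℂ) : Matrix n n ℂ) k k‖) / (Fintype.card n).factorial) := by
  by_cases hr : ∃ i j, i ≠ j ∧ ((t : Matrix.specialUnitaryGroup n ℂ) : Matrix n n ℂ) i i =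
      ((t : Matrix.specialUnitaryGroup n ℂ) : Matrix n n ℂ) j j
  · obtain ⟨i, j, hij, hd⟩ := hr
    have hfd : ((fT t : Matrix.specialUnitaryGroup n ℂ) : Matrix n n ℂ) i i =
        ((fT t : Matrix.specialUnitaryGroup n ℂ) : Matrix n n ℂ) j j :=
      torusMap_tie hf (d := fun k => ((t : Matrix.specialUnitaryGroup n ℂ) : Matrix n n ℂ) k k)
        (e := fun k => ((fT t : Matrix.specialUnitaryGroup n ℂ) : Matrix n n ℂ) k k)
        (fun k => by
          show ((fT t : Matrix.specialUnitaryGroup n ℂ) : Matrix n n ℂ) k k = _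
          rw [hfT t, diagonal_apply_eq]) hd
    rw [vandermondeWeight_eq_zero_of_tie hij hd, vandermondeWeight_eq_zero_of_tie hij hfd,
      ENNReal.ofReal_zero, mul_zero, mul_zero]
  · exact hreg g t fun i j hij hd => hr ⟨i, j, hij, hd⟩

/-- **Boyda's identity needs checking only at regular spectra (`U(n)`).** -/
theorem vandermondeIdentity_of_regular_unitary {f : (n → ℂ) → (n → ℂ)}
    (hf : ∀ (σ : Equiv.Perm n) (d : n → ℂ), f (fun k => d (σ k)) = fun k => f d (σ k))
    {fT : diagonalTorus n → diagonalTorus n}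
    (hfT : ∀ t : diagonalTorus n, ((fT t : Matrix.unitaryGroup n ℂ) : Matrix n n ℂ) =
      diagonal (f fun i => ((t : Matrix.unitaryGroup n ℂ) : Matrix n n ℂ) i i))
    {J : Matrix.unitaryGroup n ℂ → ℝ≥0∞} {Jf : diagonalTorus n → ℝ≥0∞}
    (hreg : ∀ (g : Matrix.unitaryGroup n ℂ) (t : diagonalTorus n),
      (∀ i j, i ≠ j → ((t : Matrix.unitaryGroup n ℂ) : Matrix n n ℂ) i i ≠
        ((t : Matrix.unitaryGroup n ℂ) : Matrix n n ℂ) j j) →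
      J (g * (t : Matrix.unitaryGroup n ℂ) * g⁻¹) * ENNReal.ofReal
          ((∏ i, ∏ k ∈ Finset.univ.erase i,
            ‖((t : Matrix.unitaryGroup n ℂ) : Matrix n n ℂ) i i -
              ((t : Matrix.unitaryGroup n ℂ) : Matrix n n ℂ) k k‖) / (Fintype.card n).factorial) =
        Jf t * ENNReal.ofReal
          ((∏ i, ∏ k ∈ Finset.univ.erase i,
            ‖((fT t : Matrix.unitaryGroup n ℂ) : Matrix n n ℂ) i i -
              ((fT t : Matrix.unitaryGroup n ℂ) : Matrix n n ℂ) k k‖) / (Fintype.card n).factorial))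
    (g : Matrix.unitaryGroup n ℂ) (t : diagonalTorus n) :
    J (g * (t : Matrix.unitaryGroup n ℂ) * g⁻¹) * ENNReal.ofReal
        ((∏ i, ∏ k ∈ Finset.univ.erase i,
          ‖((t : Matrix.unitaryGroup n ℂ) : Matrix n n ℂ) i i -
            ((t : Matrix.unitaryGroup n ℂ) : Matrix n n ℂ) k k‖) / (Fintype.card n).factorial) =
      Jf t * ENNReal.ofReal
        ((∏ i, ∏ k ∈ Finset.univ.erase i,
          ‖((fT t : Matrix.unitaryGroup n ℂ) : Matrix n n ℂ) i i -
            ((fT t : Matrix.unitaryGroup n ℂ) : Matrix n n ℂ) k k‖) / (Fintype.card n).factorial) := by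
  by_cases hr : ∃ i j, i ≠ j ∧ ((t : Matrix.unitaryGroup n ℂ) : Matrix n n ℂ) i i =
      ((t : Matrix.unitaryGroup n ℂ) : Matrix n n ℂ) j j
  · obtain ⟨i, j, hij, hd⟩ := hr
    have hfd : ((fT t : Matrix.unitaryGroup n ℂ) : Matrix n n ℂ) i i =
        ((fT t : Matrix.unitaryGroup n ℂ) : Matrix n n ℂ) j j :=
      torusMap_tie hf (d := fun k => ((t : Matrix.unitaryGroup n ℂ) : Matrix n n ℂ) k k)
        (e := fun k => ((fT t : Matrix.unitaryGroup n ℂ) : Matrix n n ℂ) k k)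
        (fun k => by
          show ((fT t : Matrix.unitaryGroup n ℂ) : Matrix n n ℂ) k k = _
          rw [hfT t, diagonal_apply_eq]) hd
    rw [vandermondeWeight_eq_zero_of_tie hij hd, vandermondeWeight_eq_zero_of_tie hij hfd,
      ENNReal.ofReal_zero, mul_zero, mul_zero]
  · exact hreg g t fun i j hij hd => hr ⟨i, j, hij, hd⟩

end Summit.Ventures.LatticeQCDFlow.Exactness
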